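import Summits.QuantumFields.YangMills.Theorems.IR.PurityChannelDefs
import Summits.QuantumFields.YangMills.Theorems.IR.PurityChannelClassical
import Literature.Analysis.Complex.HolomorphicParametricIntegral
import Literature.MathematicalPhysics.QuantumFieldTheory.BalabanBlockSpecification
import HarnessLib

/-!
# Crux `IR` (stmt-QuantumFields-19354) — SEAM of line `harmonic-purity-channel`, PROVED:
# `PurityChannel ∧ ComplexAnchor (∧ TwoConstants) ⇒ E`, with the shared tools of the purity-channel family

Helper module for item `stmt-QuantumFields-19354` (`--supports … --as helper`; it closes nothing).  Over the verbatim vocabulary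
`Theorems/IR/PurityChannelDefs.lean` it proves the `M/L` seam stub `stub_exit_of_channel` that the ideator (ym-ir-idea-16 g0) left
sorried in the UNREGISTERED skeleton `Cruxes/IR/Lines/harmonic_purity_channel.lean` — so that, with the classical leg T landed in
`Theorems/IR/PurityChannelClassical.lean` (p635605), the line is now `PurityChannel ∧ ComplexAnchor ⇒ E` with everything else
kernel-checked (`E = ColdPurityBridge.ColdExitSC`; `E ∧ R(proved) ∧ X ∧ N ⇒ IR` is the tree's `IR_of_bridge`).  The sibling seam of
line `jensen-purity-channel` is `Theorems/IR/PurityChannelSeamSparse.lean`.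

* §1 TOOLS (shared by both seams; second countability of `G` is the tree's `LatticeRep.secondCountableTopology`):
  `differentiableOn_weightFinTorusPartition` — **holomorphy in the weight**: `z ↦ Z[w_z](n₀,…,n₃)` is holomorphic
  on an open `D` when `z ↦ w_z(g)` is holomorphic on `D` for every `g`, each `w_z` is continuous and `‖w_z‖ ≤ B` on `D` (dominated
  holomorphic parameter integral over the compact configuration space; engine
  `Literature.Analysis.Complex.differentiableOn_integral_of_dominated`, no derivative bookkeeping); `weightFinTorusPartition_wilsonWeightC`
  — **`∏ exp = exp ∑`**: at the complex Wilson weight `Z[w]` is the tree's `wilsonFinTorusPartitionC`, hence at a real coupling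
  `1 − h_L = coldDefect` (`one_sub_purityRatio_wilsonWeightC_ofReal`).
* §2 `coldExitSC_of_channel_twoConstants : PurityChannel → ComplexAnchor → TwoConstants → ColdExitSC` — VERBATIM the body of
  `stub_exit_of_channel` (closes it by `exact`; checked on the farm against a verbatim copy of the workfile's statements): per `(G, r)`,
  `ε := ε₀` of the anchor, `β ≥ β₁(ε₀)`; `F_L = 1 − h_L[w_·]` is holomorphic on the channel (§1, denominator zero-free), `≤ 1 + M` there
  and `≤ (|C|+1)L⁴e^{−cL}` on the anchor disc (complex anchor at the `ε₀`-near-Haar weights `w_z`); two-constants with an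
  `L`-INDEPENDENT exponent `ω`; `F_L(z_T) = coldDefect r.ρ β L`; `(|C|+1)L⁴e^{−cL} → 0` picks the pure torus.  Plus the T-free form
  `coldExitSC_of_channel : PurityChannel → ComplexAnchor → ColdExitSC` over the tree theorem `twoConstants_holds`.

HONEST FRAMING.  A seam of a CONDITIONAL ideator line whose load `PurityChannel` is the infrared wall re-typed (critic ym-ir-crit-4:
STRONGER than E, width 0 toward IR) and whose supplier `ComplexAnchor` is OPEN; nothing here bears on confinement, a lattice gap,
`BalabanLadder.IR` (0/1) or the Yang–Mills mass gap (Clay), which are NOT proved; `R4` closes only the conditional finite-𝕋⁴ rung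
`BalabanLadder.UV`.
-/

set_option autoImplicit false

noncomputable section

open Filter Topology MeasureTheory
open Literature.MathematicalPhysics.QuantumFieldTheory Literature.MathematicalPhysics.QuantumLattice
open Summit.QuantumFields.YangMills.Cruxes.IR.ColdPurityBridge (coldDefect ColdExitSC)

namespace Summit.QuantumFields.YangMills.Cruxes.IR.PurityChannelFamily

/-- **T is a tree theorem** (`PurityChannelClassical.twoConstants_holds`, p635605; the body there is `TwoConstants` unfolded). -/
theorem twoConstants_holds : TwoConstants :=
  PurityChannelClassical.twoConstants_holds

/-! ## §1 Tools: the integrand; holomorphy in the weight; the Wilson weight -/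

section Tools

variable {G : Type} [Group G] [TopologicalSpace G] [IsTopologicalGroup G] [CompactSpace G]

omit [CompactSpace G] in
/-- The plaquette holonomy is a continuous function of the configuration. -/
theorem continuous_finTorusPlaquette_apply {n₀ n₁ n₂ n₃ : ℕ} (x : FinTorusSite n₀ n₁ n₂ n₃) (μ ν : Fin 4) :
    Continuous fun U : FinTorusSite n₀ n₁ n₂ n₃ × Fin 4 → G => finTorusPlaquette U x μ ν := by
  have hU : ∀ l : FinTorusSite n₀ n₁ n₂ n₃ × Fin 4,
      Continuous fun U : FinTorusSite n₀ n₁ n₂ n₃ × Fin 4 → G => U l := fun l => continuous_apply l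
  exact (((hU _).mul (hU _)).mul (hU _).inv).mul (hU _).inv

omit [CompactSpace G] in
/-- The weight integrand `U ↦ ∏_x ∏_{μ<ν} w(U_{x,μν})` is continuous for a continuous weight `w`. -/
theorem continuous_weightIntegrand {w : G → ℂ} (hw : Continuous w) (n₀ n₁ n₂ n₃ : ℕ) :
    Continuous fun U : FinTorusSite n₀ n₁ n₂ n₃ × Fin 4 → G =>
      ∏ x : FinTorusSite n₀ n₁ n₂ n₃, ∏ q : {q : Fin 4 × Fin 4 // q.1 < q.2},
        w (finTorusPlaquette U x q.1.1 q.1.2) :=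
  continuous_finsetProd _ fun x _ => continuous_finsetProd _ fun q _ =>
    hw.comp (continuous_finTorusPlaquette_apply x q.1.1 q.1.2)

omit [TopologicalSpace G] [IsTopologicalGroup G] [CompactSpace G] in
/-- Sup bound of the weight integrand: `‖∏_x ∏_{μ<ν} w(U_{x,μν})‖ ≤ ∏_x ∏_{μ<ν} B` if `‖w‖ ≤ B` pointwise. -/
theorem norm_weightIntegrand_le {w : G → ℂ} {B : ℝ} (hB : ∀ g, ‖w g‖ ≤ B) {n₀ n₁ n₂ n₃ : ℕ}
    (U : FinTorusSite n₀ n₁ n₂ n₃ × Fin 4 → G) :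
    ‖∏ x : FinTorusSite n₀ n₁ n₂ n₃, ∏ q : {q : Fin 4 × Fin 4 // q.1 < q.2},
        w (finTorusPlaquette U x q.1.1 q.1.2)‖ ≤
      ∏ _x : FinTorusSite n₀ n₁ n₂ n₃, ∏ _q : {q : Fin 4 × Fin 4 // q.1 < q.2}, B := by
  rw [norm_prod]
  refine Finset.prod_le_prod (fun x _ => norm_nonneg _) fun x _ => ?_
  rw [norm_prod]
  exact Finset.prod_le_prod (fun q _ => norm_nonneg _) fun q _ => hB _

variable [MeasurableSpace G] [BorelSpace G]

/-- **Holomorphy in the weight.**  If `z ↦ w_z(g)` is holomorphic on an open `D ⊆ ℂ` for every `g`, each `w_z` is continuous and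
`‖w_z(g)‖ ≤ B` on `D`, then `z ↦ Z[w_z](n₀,n₁,n₂,n₃)` is holomorphic on `D` (dominated holomorphic parameter integral over the compact
configuration space; engine `Literature.Analysis.Complex.differentiableOn_integral_of_dominated`). -/
theorem differentiableOn_weightFinTorusPartition [SecondCountableTopology G] {D : Set ℂ} (hD : IsOpen D)
    {w : ℂ → G → ℂ} (hwd : ∀ g, DifferentiableOn ℂ (fun z => w z g) D)
    (hwc : ∀ z ∈ D, Continuous (w z)) {B : ℝ} (hwB : ∀ z ∈ D, ∀ g, ‖w z g‖ ≤ B) (n₀ n₁ n₂ n₃ : ℕ) :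
    DifferentiableOn ℂ (fun z => weightFinTorusPartition (w z) n₀ n₁ n₂ n₃) D := by
  unfold weightFinTorusPartition
  set μ : Measure (FinTorusSite n₀ n₁ n₂ n₃ × Fin 4 → G) := Measure.pi fun _ => haarProbability G with hμ
  haveI : IsFiniteMeasure μ := by rw [hμ]; infer_instance
  refine Literature.Analysis.Complex.differentiableOn_integral_of_dominated (μ := μ)
    (F := fun z U => ∏ x : FinTorusSite n₀ n₁ n₂ n₃, ∏ q : {q : Fin 4 × Fin 4 // q.1 < q.2},
      w z (finTorusPlaquette U x q.1.1 q.1.2)) ?_ ?_ ?_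
  · intro z hz
    exact (continuous_weightIntegrand (hwc z hz) n₀ n₁ n₂ n₃).aestronglyMeasurable
  · refine Eventually.of_forall fun U => ?_
    refine DifferentiableOn.fun_finsetProd
      (f := fun x z => ∏ q : {q : Fin 4 × Fin 4 // q.1 < q.2}, w z (finTorusPlaquette U x q.1.1 q.1.2))
      fun x _ => ?_
    exact DifferentiableOn.fun_finsetProd
      (f := fun (q : {q : Fin 4 × Fin 4 // q.1 < q.2}) z => w z (finTorusPlaquette U x q.1.1 q.1.2))
      fun q _ => hwd _
  · intro x₀ hx₀
    obtain ⟨R, hR, hRD⟩ := Metric.isOpen_iff.1 hD x₀ hx₀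
    exact ⟨R, hR, hRD, fun _ => ∏ _x : FinTorusSite n₀ n₁ n₂ n₃, ∏ _q : {q : Fin 4 × Fin 4 // q.1 < q.2}, B,
      integrable_const _, Eventually.of_forall fun U z hz => norm_weightIntegrand_le (hwB z (hRD hz)) U⟩

/-- **`∏ exp = exp ∑`**: with the complex Wilson weight the weighted partition function is the tree's complex Wilson
partition function `wilsonFinTorusPartitionC`. -/
theorem weightFinTorusPartition_wilsonWeightC {N : ℕ} (ρ : G →* Matrix (Fin N) (Fin N) ℂ) (z : ℂ)
    (n₀ n₁ n₂ n₃ : ℕ) :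
    weightFinTorusPartition (wilsonWeightC ρ z) n₀ n₁ n₂ n₃ = wilsonFinTorusPartitionC ρ z n₀ n₁ n₂ n₃ := by
  unfold weightFinTorusPartition wilsonFinTorusPartitionC wilsonWeightC finTorusWilsonAction
  refine integral_congr_ae (Eventually.of_forall fun U => ?_)
  simp only [Complex.ofReal_sum, Finset.mul_sum, ← Finset.sum_neg_distrib, Complex.exp_sum]

/-- At a REAL coupling the weighted partition function of the Wilson weight is the real Wilson partition function. -/
theorem weightFinTorusPartition_wilsonWeightC_ofReal {N : ℕ} (ρ : G →* Matrix (Fin N) (Fin N) ℂ) (β : ℝ)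
    (n₀ n₁ n₂ n₃ : ℕ) :
    weightFinTorusPartition (wilsonWeightC ρ (β : ℂ)) n₀ n₁ n₂ n₃ =
      ((wilsonFinTorusPartition ρ β n₀ n₁ n₂ n₃ : ℝ) : ℂ) := by
  rw [weightFinTorusPartition_wilsonWeightC, wilsonFinTorusPartitionC_ofReal]

/-- At a real coupling `1 − h_L[Wilson weight] = coldDefect` (cast to `ℂ`). -/
theorem one_sub_purityRatio_wilsonWeightC_ofReal {N : ℕ} (ρ : G →* Matrix (Fin N) (Fin N) ℂ) (β : ℝ) (L : ℕ) :
    1 - purityRatio (wilsonWeightC ρ (β : ℂ)) L = ((coldDefect ρ β L : ℝ) : ℂ) := by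
  simp only [purityRatio, weightFinTorusPartition_wilsonWeightC_ofReal, coldDefect]
  push_cast
  rfl

end Tools

/-! ## §2 The SEAM of line harmonic-purity-channel: `PurityChannel ∧ ComplexAnchor ∧ TwoConstants ⇒ E` -/

/-- The polynomial-times-exponential anchor bound tends to zero: `K · L⁴ · e^{−cL} → 0` (`c > 0`). -/
theorem tendsto_const_mul_pow_four_mul_exp_neg (K : ℝ) {c : ℝ} (hc : 0 < c) :
    Tendsto (fun L : ℕ => K * (L : ℝ) ^ 4 * Real.exp (-(c * (L : ℝ)))) atTop (𝓝 0) := by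
  have h1 : Tendsto (fun L : ℕ => c * (L : ℝ)) atTop atTop :=
    tendsto_natCast_atTop_atTop.const_mul_atTop hc
  have h2 : Tendsto (fun L : ℕ => (c * (L : ℝ)) ^ 4 * Real.exp (-(c * (L : ℝ)))) atTop (𝓝 0) :=
    (Real.tendsto_pow_mul_exp_neg_atTop_nhds_zero 4).comp h1
  have h3 := h2.const_mul (K / c ^ 4)
  rw [mul_zero] at h3
  refine h3.congr fun L => ?_
  field_simp

/-- **SEAM (body of `stub_exit_of_channel`, line harmonic-purity-channel): `PurityChannel → ComplexAnchor → TwoConstants →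
ColdExitSC`.**  Per `(G, r)`: take the anchor tolerance `ε₀`; for `β ≥ β₁(ε₀)` the channel data `(D, w, z₀, zT, δ₀, M)`; the function
`F_L(z) = 1 − h_L[w_z]` is holomorphic on `D` for `L ≥ L₀` (holomorphy in the weight, denominator zero-free on `D`), bounded by
`1 + M ≤ A` on `D` and by `a_L = (|C|+1) L⁴ e^{−cL}` on the anchor disc (complex anchor at the `ε₀`-near-Haar weights `w_z`);
two-constants gives `‖F_L(zT)‖ ≤ a_L^ω A^{1−ω} → 0` with `ω` INDEPENDENT of `L`; at `zT` the weight is Wilson's at `β`, so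
`F_L(zT) = coldDefect r.ρ β L` and purity `≤ ε` holds at all large `L`. -/
theorem coldExitSC_of_channel_twoConstants (hZ : PurityChannel) (hA : ComplexAnchor) (hT : TwoConstants) :
    ColdExitSC := by
  intro G _ _ _ _ hG hsc
  letI : MeasurableSpace G := borel G
  haveI : BorelSpace G := ⟨rfl⟩
  intro r ε hε
  haveI : SecondCountableTopology G := r.secondCountableTopology
  obtain ⟨ε₀, C, c, hε₀, hc, L₀A, hAnch⟩ := hA
  obtain ⟨β₁, hβ₁⟩ := hZ G hG hsc r ε₀ hε₀
  refine ⟨β₁, fun β hβ L₁ => ?_⟩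
  obtain ⟨D, w, z₀, zT, δ₀, M, B, L₀Z, hDo, hDc, hδ₀, hdisc, hzT, hwd, hwc, hwB, hw1, hwT, hL⟩ := hβ₁ β hβ
  obtain ⟨ω, hω0, hω1, hTC⟩ := hT D hDo hDc z₀ δ₀ hδ₀ hdisc zT hzT
  -- the contour bound `A ≥ 1 + M`, `A ≥ 1`, and the anchor smallness `a_L → 0`
  set A : ℝ := max M 0 + 1 with hAdef
  have hA1 : 1 ≤ A := by
    have : 0 ≤ max M 0 := le_max_right _ _
    linarith
  have hMA : 1 + M ≤ A := by
    have : M ≤ max M 0 := le_max_left _ _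
    linarith
  set a : ℕ → ℝ := fun L => (|C| + 1) * (L : ℝ) ^ 4 * Real.exp (-(c * (L : ℝ))) with hadef
  have ha : Tendsto a atTop (𝓝 0) := tendsto_const_mul_pow_four_mul_exp_neg (|C| + 1) hc
  have hb : Tendsto (fun L => a L ^ ω * A ^ (1 - ω)) atTop (𝓝 0) := by
    have := (ha.rpow_const (Or.inr hω0.le)).mul_const (A ^ (1 - ω))
    simpa [Real.zero_rpow hω0.ne'] using this
  obtain ⟨L, ⟨⟨hLε, hLa1⟩, hL1⟩, hLmax⟩ :=
    ((((hb.eventually_le_const hε).and (ha.eventually_le_const one_pos)).and (eventually_ge_atTop 1)).and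
      (eventually_ge_atTop (max L₁ (max L₀A L₀Z)))).exists
  have hLL₁ : L₁ ≤ L := (le_max_left _ _).trans hLmax
  have hLA : L₀A ≤ L := ((le_max_left _ _).trans (le_max_right _ _)).trans hLmax
  have hLZ : L₀Z ≤ L := ((le_max_right _ _).trans (le_max_right _ _)).trans hLmax
  refine ⟨L, hLL₁, ?_⟩
  have hZt : ∀ z ∈ D, weightFinTorusPartition (w z) L L L (L / 4) ≠ 0 := fun z hz => (hL L hLZ z hz).1
  have hM : ∀ z ∈ D, ‖purityRatio (w z) L‖ ≤ M := fun z hz => (hL L hLZ z hz).2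
  -- the holomorphic function `F_L = 1 − h_L[w_·]`
  set F : ℂ → ℂ := fun z => 1 - purityRatio (w z) L with hF
  have hpr : DifferentiableOn ℂ (fun z => purityRatio (w z) L) D := by
    have h1 := differentiableOn_weightFinTorusPartition hDo hwd hwc hwB L L L (2 * (L / 4))
    have h2 := differentiableOn_weightFinTorusPartition hDo hwd hwc hwB L L L (L / 4)
    simp only [purityRatio]
    exact h1.div (h2.pow 2) fun z hz => pow_ne_zero 2 (hZt z hz)
  have hFd : DifferentiableOn ℂ F D := (differentiableOn_const (1 : ℂ)).sub hpr
  have hFA : ∀ z ∈ D, ‖F z‖ ≤ A := fun z hz =>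
    calc ‖F z‖ ≤ ‖(1 : ℂ)‖ + ‖purityRatio (w z) L‖ := norm_sub_le _ _
      _ ≤ 1 + M := by rw [norm_one]; linarith [hM z hz]
      _ ≤ A := hMA
  have hLpos : (0 : ℝ) < L := by exact_mod_cast hL1
  have ha_pos : 0 < a L := by
    simp only [hadef]
    positivity
  have hFa : ∀ z ∈ Metric.closedBall z₀ δ₀, ‖F z‖ ≤ a L := fun z hz => by
    have hzD : z ∈ D := hdisc hz
    have h := (hAnch G (w z) (hwc z hzD) (hw1 z hz) L hLA).2
    calc ‖F z‖ ≤ C * (L : ℝ) ^ 4 * Real.exp (-(c * (L : ℝ))) := h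
      _ ≤ (|C| + 1) * (L : ℝ) ^ 4 * Real.exp (-(c * (L : ℝ))) := by
          gcongr
          exact (le_abs_self C).trans (le_add_of_nonneg_right zero_le_one)
  have key := hTC F hFd (a L) A ha_pos (hLa1.trans hA1) hFA hFa
  -- at the target the weight is Wilson's: `F_L(zT) = coldDefect r.ρ β L`
  have hFzT : F zT = ((coldDefect r.ρ β L : ℝ) : ℂ) := by
    simp only [hF, hwT]
    exact one_sub_purityRatio_wilsonWeightC_ofReal r.ρ β L
  have hle : coldDefect r.ρ β L ≤ ‖F zT‖ := by
    rw [hFzT, Complex.norm_real, Real.norm_eq_abs]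
    exact le_abs_self _
  exact hle.trans (key.trans hLε)

/-- **SEAM, UNCONDITIONAL IN T** (T is the tree theorem `PurityChannelClassical.twoConstants_holds`, p635605):
`PurityChannel → ComplexAnchor → ColdExitSC` — line harmonic-purity-channel reduces to its LOAD and its located supplier. -/
theorem coldExitSC_of_channel (hZ : PurityChannel) (hA : ComplexAnchor) : ColdExitSC :=
  coldExitSC_of_channel_twoConstants hZ hA twoConstants_holds


end Summit.QuantumFields.YangMills.Cruxes.IR.PurityChannelFamily

end
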